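/-
Copyright (c) 2026. All rights reserved.
Released under Apache 2.0 license as described in the file LICENSE.
Authors: abc-iut cell, prover seat abc-iut-w5-d180 (wave 5, gen 7).
-/
import Literature.IUT.LogVolume.TensorPacketLicenceExactFactorwise
import Literature.IUT.LogVolume.TensorPacketFactorDifferentMin
import HarnessLib

/-!
# The per-summand (xi-f) cell of the R-W window in CONTENT-VALUE and INTEGER ORDERS form
# (the diagonal packet of one local field: `m_q ≥ e·⌊(M − j·D − (j+1)·R_in)/e⌋ + (j+1)·R_out`)

abc-iut cell, seat abc-iut-w5-d180 (D-0079 sub-cell R-W «WINDOW Θ-SIDE INEQUALITY», lane U; the content-value / floor-form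
corollary asked for by abc-iut-c312-5 on closing task T2, 2026-08-26T16:31Z).  PROOF-ONLY file (no definitions, no named `Prop`
facts): integer bookkeeping over abc-iut-c312-5's EXACT per-summand cell `iota_smul_subset_packetHull_orbit_iota_smul_iff` /
`iota_smul_subset_packetHull_factorwiseOrbit_iota_smul_iff` (`TensorPacketLicenceExact(Factorwise)`, p455852 / p456196) and
abc-iut-w6-d018's least factor different `inf_differentOrd_dFac_eq_of_algEquiv` (`TensorPacketFactorDifferentMin`).

WHY.  The kernel cell is a `∀ m : ℤ` implication between REAL inequalities (`(p : ℝ)^m·‖t_Θ‖ ≤ p^{−(d_I − d_{L_J})}·∏ρ_in → (p : ℝ)^m·‖t_q‖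
≤ ∏ρ_out`).  The R-W table of record (`HOME/plan/rescue/R-W/WINDOW-TABLE.tsv`, columns 28–29) and the licence-level wrappers want ONE
integer predicate in the orders of the ideles and the two lattice integers of the log-unit lattice.  This file supplies it and, in
passing, pins the SIGN of the outer-radius term (the prose reading «`v_p(t_q) + Σβ ≥ content`» circulating in the cell has `Σβ` on the
wrong side; the kernel statements are and stay correct):

* §1 `forall_dFac_le_rpow_mul_iff_inf` — the family of hypotheses over the factor fields `J` is the single hypothesis at the LEAST
  factor different `min_J d_{L_J}` (the right-hand side `p^{−(d_I − d_{L_J})}·C` is smallest there);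
* §2 `iota_smul_subset_packetHull_orbit_iota_smul_iff_card` (+ factorwise twin) — the DIAGONAL packet of ONE field `K` (all
  `|I| = j+1` slots equal, `K` arbitrary: wild, `p = 2`, non-Galois allowed): `d_I − min_J d_{L_J} = (|I| − 1)·d_K` EXACTLY
  (abc-iut-w6-d018), so the cell reads `∀ m, (p^m·‖t_Θ‖ ≤ p^{−(|I|−1)·d_K}·∏ρ_in → p^m·‖t_q‖ ≤ ∏ρ_out)`;
* §3 `forall_int_mul_le_imp_iff_ediv` — the integer heart: for `0 < e`,
  `(∀ m, m·e ≤ N → e·m + R ≤ q) ⟺ e·(N / e) + R ≤ q` (`/` = `Int` floor division);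
* §4 **`iota_smul_subset_packetHull_orbit_iota_smul_iff_orders`** (+ `…factorwiseOrbit…_orders`) — with a norm uniformiser `ϖ`
  (`‖ϖ‖ = p^{−1/e}`), different exponent `D` (`d_K = D/e`), inner radius `‖c_in‖ = ‖ϖ‖^{R_in}`, outer radius `‖c_out‖ = ‖ϖ‖^{R_out}`,
  `‖t_Θ‖ = ‖ϖ‖^{M}`, `‖t_q‖ = ‖ϖ‖^{m_q}`:
  **cell ⟺ `e·⌊(M − (|I|−1)·D − |I|·R_in)/e⌋ + |I|·R_out ≤ m_q`.**

SANITY (numbers, not adjectives).  U1 (tame, `e ≤ p − 2`): `R_in = R_out = 1`, `D = e − 1`, `|I| = j+1` ⇒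
`e·⌊(M − 1 − j·e)/e⌋ + j + 1 = e·⌊(M−1)/e⌋ + 1 − j·(e−1)` — abc-iut-w5-d180 g5's exact tame dichotomy
(`Cor312LicenceExplicitDepthExact.licence_settingDHVolSharp_iff_of_tame_orders_single`) verbatim; U1½ (`e = p−1`, `ζ_p ∉ K`,
`log_p(𝒪^×) = 𝔪`): the same numbers (abc-iut-D1-prv `Cor312LicenceTameBoundary`); U2: `R_in = ⌊e/(p−1)⌋ + 1` at `(p−1) ∤ e`,
`R_out = p^{a₀} − a₀·e` off the ties `e = p^a(p−1)` (abc-iut-c312-3 `UnitLogMaxNorm`, abc-iut-f-167 `UnitLogWildDepth`) — `R_out ≤ 0`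
as soon as `e ≥ p`.  The (Ind2) and the hull are the tree's typings of disputed-corpus constructions; the per-summand cell is a
STRONGER-THAN-PRINT reading of [IUTchIII] Cor. 3.12 Step (xi-f); nothing here bears on the printed inequality; no side taken on
[IUTchIII] Cor. 3.12 or on any author.  [cite: Mochizuki2012, IUTchIV Prop. 1.1 p. 9, Prop. 1.2 (i)(ii) p. 10; IUTchIII Rmk. 3.9.5 (i)
p. 127] [cite: DupuyHilado2025, §3.7, §4.9, §4.12] [claim: Mochizuki2012, status: disputed].
-/

noncomputable section

open Set Module Function
open scoped Pointwise TensorProduct NormedField nonZeroDivisors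

namespace Literature.IUT.LogVolume

open Literature.NumberTheory.GaloisRepresentations.Ultrametric

variable (p : ℕ) [Fact p.Prime]
variable {I : Type} [Fintype I] [DecidableEq I] [Nonempty I]

/-! ## 1. The hypotheses over the factor fields collapse to the least factor different -/

section General

variable (k : I → Type) [∀ i, NontriviallyNormedField (k i)] [∀ i, NormedAlgebra ℚ_[p] (k i)]
  [∀ i, IsUltrametricDist (k i)] [∀ i, ProperSpace (k i)]

omit [DecidableEq I] [Nonempty I] in
/-- **`∀ J, x ≤ p^{−(d_I − d_{L_J})}·C` iff `x ≤ p^{−(d_I − min_J d_{L_J})}·C`** (`C ≥ 0`): the right-hand side is monotone in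
`d_{L_J}` and the minimum is attained. [cite: Mochizuki2012, IUTchIV Prop. 1.1 p. 9] -/
theorem forall_dFac_le_rpow_mul_iff_inf {x C : ℝ} (hC : 0 ≤ C) :
    (∀ J : DIdx p k, x ≤ (p : ℝ) ^ (-(dSum p k - differentOrd p (DFac p k J))) * C) ↔
      x ≤ (p : ℝ) ^ (-(dSum p k - (Finset.univ : Finset (DIdx p k)).inf' Finset.univ_nonempty
        (fun J => differentOrd p (DFac p k J)))) * C := by
  have hp1 : (1 : ℝ) ≤ p := by exact_mod_cast (Fact.out : p.Prime).one_lt.le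
  constructor
  · intro h
    obtain ⟨J₀, -, hJ₀⟩ := Finset.exists_mem_eq_inf' (Finset.univ_nonempty : (Finset.univ :
      Finset (DIdx p k)).Nonempty) (fun J => differentOrd p (DFac p k J))
    rw [hJ₀]
    exact h J₀
  · intro h J
    refine h.trans (mul_le_mul_of_nonneg_right (Real.rpow_le_rpow_of_exponent_le hp1 ?_) hC)
    have hle : (Finset.univ : Finset (DIdx p k)).inf' Finset.univ_nonempty (fun J => differentOrd p (DFac p k J)) ≤
        differentOrd p (DFac p k J) := Finset.inf'_le _ (Finset.mem_univ J)
    linarith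

/-- **Content-value form of abc-iut-c312-5's cell (Dupuy–Hilado's full (Ind2))**: the `∀ J` hypothesis replaced by the single one
at `min_J d_{L_J}`. [cite: DupuyHilado2025, §4.9, §4.12] [cite: Mochizuki2012, IUTchIV Prop. 1.1 p. 9] -/
theorem iota_smul_subset_packetHull_orbit_iota_smul_iff_inf {cin cout : Π i, k i} (hin0 : ∀ i, cin i ≠ 0)
    (hin : ∀ i (o : k i), ‖o‖ ≤ 1 → cin i * o ∈ logUnits (k i))
    (hmax : ∀ i, ∃ (ϖ : (k i)ˣ) (w : k i), IsUniformizer ϖ ∧ w ∉ logUnits (k i) ∧ ‖w‖ * ‖(ϖ : k i)‖ ≤ ‖cin i‖)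
    (hout0 : ∀ i, cout i ≠ 0) (houtΛ : ∀ i, cout i ∈ logUnits (k i))
    (hdom : ∀ i, ∀ z ∈ logUnits (k i), ‖z‖ ≤ ‖cout i‖)
    (b b' : I) {tΘ : k b} (htΘ : tΘ ≠ 0) (tq : k b') :
    iota p k b' tq • (normalizedPacket p k : Set (PacketAlgebra p k)) ⊆
        packetHull p k (⋃ g : indTwo p k, g • (iota p k b tΘ • (normalizedPacket p k : Set (PacketAlgebra p k)))) ↔
      ∀ m : ℤ, (p : ℝ) ^ m * ‖tΘ‖ ≤ (p : ℝ) ^ (-(dSum p k - (Finset.univ : Finset (DIdx p k)).inf' Finset.univ_nonempty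
          (fun J => differentOrd p (DFac p k J)))) * ∏ i, ‖cin i‖ →
        (p : ℝ) ^ m * ‖tq‖ ≤ ∏ i, ‖cout i‖ := by
  rw [iota_smul_subset_packetHull_orbit_iota_smul_iff p k hin0 hin hmax hout0 houtΛ hdom b b' htΘ tq]
  refine forall_congr' fun m => ?_
  rw [forall_dFac_le_rpow_mul_iff_inf p k (Finset.prod_nonneg fun i _ => norm_nonneg (cin i))]

/-- **Content-value form, FACTORWISE (Ind2)** ([IUTchIII] Thm. 3.11 (i): independent lattice automorphisms per slot — the cell's typed
(Ind2) at the real settings). [cite: Mochizuki2012, IUTchIII Thm. 3.11 (i) (Ind2) p. 154] [cite: DupuyHilado2025, §4.9] -/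
theorem iota_smul_subset_packetHull_factorwiseOrbit_iota_smul_iff_inf {cin cout : Π i, k i} (hin0 : ∀ i, cin i ≠ 0)
    (hin : ∀ i (o : k i), ‖o‖ ≤ 1 → cin i * o ∈ logUnits (k i))
    (hmax : ∀ i, ∃ (ϖ : (k i)ˣ) (w : k i), IsUniformizer ϖ ∧ w ∉ logUnits (k i) ∧ ‖w‖ * ‖(ϖ : k i)‖ ≤ ‖cin i‖)
    (hout0 : ∀ i, cout i ≠ 0) (houtΛ : ∀ i, cout i ∈ logUnits (k i))
    (hdom : ∀ i, ∀ z ∈ logUnits (k i), ‖z‖ ≤ ‖cout i‖)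
    (b b' : I) {tΘ : k b} (htΘ : tΘ ≠ 0) (tq : k b') :
    iota p k b' tq • (normalizedPacket p k : Set (PacketAlgebra p k)) ⊆
        packetHull p k (⋃ g ∈ {g : ∀ i, k i ≃ₗ[ℚ_[p]] k i | ∀ i, g i '' logUnits (k i) = logUnits (k i)},
          (PiTensorProduct.congr g : PacketAlgebra p k ≃ₗ[ℚ_[p]] PacketAlgebra p k) ''
            (iota p k b tΘ • (normalizedPacket p k : Set (PacketAlgebra p k)))) ↔
      ∀ m : ℤ, (p : ℝ) ^ m * ‖tΘ‖ ≤ (p : ℝ) ^ (-(dSum p k - (Finset.univ : Finset (DIdx p k)).inf' Finset.univ_nonempty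
          (fun J => differentOrd p (DFac p k J)))) * ∏ i, ‖cin i‖ →
        (p : ℝ) ^ m * ‖tq‖ ≤ ∏ i, ‖cout i‖ := by
  rw [iota_smul_subset_packetHull_factorwiseOrbit_iota_smul_iff p k hin0 hin hmax hout0 houtΛ hdom b b' htΘ tq]
  refine forall_congr' fun m => ?_
  rw [forall_dFac_le_rpow_mul_iff_inf p k (Finset.prod_nonneg fun i _ => norm_nonneg (cin i))]

end General

/-! ## 2. The diagonal packet of ONE field: `d_I − min_J d_{L_J} = (|I| − 1)·d_K` -/

section Diagonal

variable (K : Type) [NontriviallyNormedField K] [NormedAlgebra ℚ_[p] K] [IsUltrametricDist K] [ProperSpace K]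

/-- For the constant family `k_i = K`: `d_I − min_J d_{L_J} = (|I| − 1)·d_K` (abc-iut-w6-d018, equal slots, no normality).
[cite: Mochizuki2012, IUTchIV Prop. 1.1 p. 9] -/
theorem dSum_sub_inf_differentOrd_dFac_const :
    dSum p (fun _ : I => K) - (Finset.univ : Finset (DIdx p (fun _ : I => K))).inf' Finset.univ_nonempty
        (fun J => differentOrd p (DFac p (fun _ : I => K) J)) =
      ((Fintype.card I : ℝ) - 1) * differentOrd p K := by
  obtain ⟨i₀⟩ := (inferInstance : Nonempty I)
  exact dSum_sub_inf_differentOrd_dFac_eq_of_algEquiv p (fun _ : I => K) i₀ fun _ => AlgEquiv.refl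

/-- **The cell at the DIAGONAL packet of one field `K`** (all `|I|` slots equal; `K` arbitrary — wild, `p = 2`, non-Galois allowed),
Dupuy–Hilado's full (Ind2): `∀ m, (p^m·‖t_Θ‖ ≤ p^{−(|I|−1)·d_K}·∏ρ_in → p^m·‖t_q‖ ≤ ∏ρ_out)`.
[cite: DupuyHilado2025, §4.9, §4.12] [cite: Mochizuki2012, IUTchIV Prop. 1.1 p. 9] -/
theorem iota_smul_subset_packetHull_orbit_iota_smul_iff_card {cin cout : I → K} (hin0 : ∀ i, cin i ≠ 0)
    (hin : ∀ i (o : K), ‖o‖ ≤ 1 → cin i * o ∈ logUnits K)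
    (hmax : ∀ i, ∃ (ϖ : Kˣ) (w : K), IsUniformizer ϖ ∧ w ∉ logUnits K ∧ ‖w‖ * ‖(ϖ : K)‖ ≤ ‖cin i‖)
    (hout0 : ∀ i, cout i ≠ 0) (houtΛ : ∀ i, cout i ∈ logUnits K) (hdom : ∀ i, ∀ z ∈ logUnits K, ‖z‖ ≤ ‖cout i‖)
    (b b' : I) {tΘ : K} (htΘ : tΘ ≠ 0) (tq : K) :
    iota p (fun _ : I => K) b' tq • (normalizedPacket p (fun _ : I => K) : Set (PacketAlgebra p (fun _ : I => K))) ⊆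
        packetHull p (fun _ : I => K) (⋃ g : indTwo p (fun _ : I => K),
          g • (iota p (fun _ : I => K) b tΘ • (normalizedPacket p (fun _ : I => K) : Set (PacketAlgebra p (fun _ : I => K))))) ↔
      ∀ m : ℤ, (p : ℝ) ^ m * ‖tΘ‖ ≤ (p : ℝ) ^ (-(((Fintype.card I : ℝ) - 1) * differentOrd p K)) * ∏ i, ‖cin i‖ →
        (p : ℝ) ^ m * ‖tq‖ ≤ ∏ i, ‖cout i‖ := by
  rw [iota_smul_subset_packetHull_orbit_iota_smul_iff_inf p (fun _ : I => K) hin0 hin hmax hout0 houtΛ hdom b b' htΘ tq,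
    dSum_sub_inf_differentOrd_dFac_const p K]

/-- **The cell at the diagonal packet of one field, FACTORWISE (Ind2).**
[cite: Mochizuki2012, IUTchIII Thm. 3.11 (i) (Ind2) p. 154] [cite: DupuyHilado2025, §4.9] -/
theorem iota_smul_subset_packetHull_factorwiseOrbit_iota_smul_iff_card {cin cout : I → K} (hin0 : ∀ i, cin i ≠ 0)
    (hin : ∀ i (o : K), ‖o‖ ≤ 1 → cin i * o ∈ logUnits K)
    (hmax : ∀ i, ∃ (ϖ : Kˣ) (w : K), IsUniformizer ϖ ∧ w ∉ logUnits K ∧ ‖w‖ * ‖(ϖ : K)‖ ≤ ‖cin i‖)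
    (hout0 : ∀ i, cout i ≠ 0) (houtΛ : ∀ i, cout i ∈ logUnits K) (hdom : ∀ i, ∀ z ∈ logUnits K, ‖z‖ ≤ ‖cout i‖)
    (b b' : I) {tΘ : K} (htΘ : tΘ ≠ 0) (tq : K) :
    iota p (fun _ : I => K) b' tq • (normalizedPacket p (fun _ : I => K) : Set (PacketAlgebra p (fun _ : I => K))) ⊆
        packetHull p (fun _ : I => K) (⋃ g ∈ {g : ∀ _ : I, K ≃ₗ[ℚ_[p]] K | ∀ i, g i '' logUnits K = logUnits K},
          (PiTensorProduct.congr g : PacketAlgebra p (fun _ : I => K) ≃ₗ[ℚ_[p]] PacketAlgebra p (fun _ : I => K)) ''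
            (iota p (fun _ : I => K) b tΘ • (normalizedPacket p (fun _ : I => K) : Set (PacketAlgebra p (fun _ : I => K))))) ↔
      ∀ m : ℤ, (p : ℝ) ^ m * ‖tΘ‖ ≤ (p : ℝ) ^ (-(((Fintype.card I : ℝ) - 1) * differentOrd p K)) * ∏ i, ‖cin i‖ →
        (p : ℝ) ^ m * ‖tq‖ ≤ ∏ i, ‖cout i‖ := by
  rw [iota_smul_subset_packetHull_factorwiseOrbit_iota_smul_iff_inf p (fun _ : I => K) hin0 hin hmax hout0 houtΛ hdom b b' htΘ
    tq, dSum_sub_inf_differentOrd_dFac_const p K]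

end Diagonal

/-! ## 3. The integer heart -/

/-- **`(∀ m, m·e ≤ N → e·m + R ≤ q) ⟺ e·(N / e) + R ≤ q`** for `0 < e` (`/` the `Int` floor division): the largest admissible
`m` is `N / e`. [folklore] -/
private theorem forall_int_mul_le_imp_iff_ediv {e : ℤ} (he : 0 < e) (N R q : ℤ) :
    (∀ m : ℤ, m * e ≤ N → e * m + R ≤ q) ↔ e * (N / e) + R ≤ q := by
  constructor
  · intro h
    exact h (N / e) (Int.ediv_mul_le N he.ne')
  · intro h m hm
    have hm' : m ≤ N / e := Int.le_ediv_of_mul_le he hm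
    nlinarith

/-- **Tame sanity check of the integer predicate** (`D = e − 1`, `R_in = R_out = 1`, `|I| = j + 1`):
`e·⌊(M − j(e−1) − (j+1))/e⌋ + (j+1) ≤ m_q ⟺ e·⌊(M−1)/e⌋ + 1 − j(e−1) ≤ m_q` — the shape of abc-iut-w5-d180 g5's
`licence_settingDHVolSharp_iff_of_tame_orders_single` / abc-iut-w5-d009's `licence_settingPrVolSharp_iff_of_realises_tame` (the tame
case of [IUTchIV] Prop. 1.2 (iii): `e_i ≤ p − 2`, `log_p(R_i^×) = 𝔪_i`, `d_i = (e_i−1)/e_i`). [cite: Mochizuki2012, IUTchIV Prop. 1.2 (iii) p. 11] -/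
theorem orders_predicate_tame_iff {e : ℤ} (he : e ≠ 0) (M mq : ℤ) (j : ℕ) :
    e * ((M - (j : ℤ) * (e - 1) - ((j : ℤ) + 1) * 1) / e) + ((j : ℤ) + 1) * 1 ≤ mq ↔
      e * ((M - 1) / e) + 1 - (j : ℤ) * (e - 1) ≤ mq := by
  have h : M - (j : ℤ) * (e - 1) - ((j : ℤ) + 1) * 1 = (M - 1) + (-(j : ℤ)) * e := by ring
  have h' : e * ((M - 1) / e + -(j : ℤ)) + ((j : ℤ) + 1) * 1 = e * ((M - 1) / e) + 1 - (j : ℤ) * (e - 1) := by ring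
  rw [h, Int.add_mul_ediv_right _ _ he, h']

/-! ## 4. INTEGER ORDERS FORM at the diagonal packet of one field -/

section Orders

variable {K : Type} [NontriviallyNormedField K] [NormedAlgebra ℚ_[p] K] [IsUltrametricDist K] [ProperSpace K]

/-- `‖ϖ‖^z = p^{−z/e}` for a norm uniformiser and `z ∈ ℤ` (plumbing; cf. abc-iut-c312-3's
`Thm311.Real.norm_unif_zpow_eq_rpow`). [cite: NeukirchANT1999, Ch. II (5.5)] -/
private theorem norm_uniformizer_zpow_eq_rpow {ϖ : Kˣ} (hϖ : IsUniformizer ϖ) (z : ℤ) :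
    ‖(ϖ : K)‖ ^ z = (p : ℝ) ^ (-((z : ℝ) / absRamificationIdx p K)) := by
  have hp0 : (0 : ℝ) ≤ p := by positivity
  rw [norm_eq_rpow_of_isUniformizer p K hϖ, ← Real.rpow_intCast, ← Real.rpow_mul hp0]
  congr 1
  ring

/-- Real bookkeeping: with `‖ϖ‖ = p^{−1/e}`, the inequality `p^m·‖ϖ‖^A ≤ p^{−X}·(‖ϖ‖^B)^n` is `m·e − A ≤ −X·e − n·B`.
[cite: NeukirchANT1999, Ch. II (5.5)] -/
theorem zpow_mul_norm_zpow_le_iff {ϖ : Kˣ} (hϖ : IsUniformizer ϖ) (m A B : ℤ) (X : ℝ) (n : ℕ) :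
    (p : ℝ) ^ m * ‖(ϖ : K)‖ ^ A ≤ (p : ℝ) ^ (-X) * (‖(ϖ : K)‖ ^ B) ^ n ↔
      (m : ℝ) * absRamificationIdx p K - A ≤ -X * absRamificationIdx p K - n * B := by
  have hp : p.Prime := Fact.out
  have hp1 : (1 : ℝ) < p := by exact_mod_cast hp.one_lt
  have hp0 : (0 : ℝ) < p := by linarith
  have he : (0 : ℝ) < absRamificationIdx p K := by exact_mod_cast absRamificationIdx_pos p K
  rw [norm_uniformizer_zpow_eq_rpow p hϖ A, norm_uniformizer_zpow_eq_rpow p hϖ B, ← Real.rpow_intCast,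
    ← Real.rpow_add hp0, ← Real.rpow_natCast, ← Real.rpow_mul hp0.le, ← Real.rpow_add hp0,
    Real.rpow_le_rpow_left_iff hp1]
  have key1 : ((m : ℤ) : ℝ) + -((A : ℝ) / absRamificationIdx p K) =
      ((m : ℝ) * absRamificationIdx p K - A) / absRamificationIdx p K := by
    rw [eq_div_iff he.ne']; field_simp; ring
  have key2 : -X + -((B : ℝ) / absRamificationIdx p K) * (n : ℝ) =
      (-X * absRamificationIdx p K - n * B) / absRamificationIdx p K := by
    rw [eq_div_iff he.ne']; field_simp; ring
  rw [key1, key2, div_le_div_iff_of_pos_right he]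

/-- **THE CELL IN INTEGER ORDERS (Dupuy–Hilado's full (Ind2)).**  At the diagonal packet of ONE local field `K` (any ramification,
any `p`): norm uniformiser `ϖ`, `e = e(K/ℚ_p)`, different exponent `D` (`d_K = D/e`), inner radius `‖c_in‖ = ‖ϖ‖^{R_in}` (the largest
ball `c_in·𝒪_K ⊆ log_p(𝒪_K^×)`), outer radius `‖c_out‖ = ‖ϖ‖^{R_out}` (the largest norm on `log_p(𝒪_K^×)`), `‖t_Θ‖ = ‖ϖ‖^M`,
`‖t_q‖ = ‖ϖ‖^{m_q}`.  Then the q-box lies in the holomorphic hull of the (Ind2)-orbit of the Θ-box IFF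
**`e·⌊(M − (|I|−1)·D − |I|·R_in)/e⌋ + |I|·R_out ≤ m_q`** (i.e. `v_p(t_q) ≥ content + Σβ`, `β = R_out/e` — NOT `v_p(t_q) + Σβ ≥ content`).
Tame (`R_in = R_out = 1`, `D = e−1`, `|I| = j+1`): `e·⌊(M−1)/e⌋ + 1 − j(e−1) ≤ m_q`, abc-iut-w5-d180 g5's exact dichotomy verbatim.
[cite: DupuyHilado2025, §4.9, §4.12] [cite: Mochizuki2012, IUTchIV Prop. 1.1 p. 9, Prop. 1.2 (i)(ii) p. 10] -/
theorem iota_smul_subset_packetHull_orbit_iota_smul_iff_orders {ϖ : Kˣ} (hϖ : IsUniformizer ϖ) {D : ℕ}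
    (hD : differentOrd p K = (D : ℝ) / absRamificationIdx p K) {cin cout : K}
    (hin : ∀ o : K, ‖o‖ ≤ 1 → cin * o ∈ logUnits K)
    (hmax : ∃ (ϖ' : Kˣ) (w : K), IsUniformizer ϖ' ∧ w ∉ logUnits K ∧ ‖w‖ * ‖(ϖ' : K)‖ ≤ ‖cin‖)
    (houtΛ : cout ∈ logUnits K) (hdom : ∀ z ∈ logUnits K, ‖z‖ ≤ ‖cout‖)
    {Rin Rout : ℤ} (hRin : ‖cin‖ = ‖(ϖ : K)‖ ^ Rin) (hRout : ‖cout‖ = ‖(ϖ : K)‖ ^ Rout)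
    (b b' : I) {tΘ tq : K} {M mq : ℤ} (hΘ : ‖tΘ‖ = ‖(ϖ : K)‖ ^ M) (hq : ‖tq‖ = ‖(ϖ : K)‖ ^ mq) :
    iota p (fun _ : I => K) b' tq • (normalizedPacket p (fun _ : I => K) : Set (PacketAlgebra p (fun _ : I => K))) ⊆
        packetHull p (fun _ : I => K) (⋃ g : indTwo p (fun _ : I => K),
          g • (iota p (fun _ : I => K) b tΘ • (normalizedPacket p (fun _ : I => K) : Set (PacketAlgebra p (fun _ : I => K))))) ↔
      (absRamificationIdx p K : ℤ) * ((M - (Fintype.card I - 1 : ℕ) * (D : ℤ) - Fintype.card I * Rin) / absRamificationIdx p K) +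
          Fintype.card I * Rout ≤ mq := by
  have hϖ0 : 0 < ‖(ϖ : K)‖ := norm_pos_iff.2 ϖ.ne_zero
  have hcin0 : cin ≠ 0 := by
    rw [← norm_pos_iff, hRin]; exact zpow_pos hϖ0 _
  have hcout0 : cout ≠ 0 := by
    rw [← norm_pos_iff, hRout]; exact zpow_pos hϖ0 _
  have htΘ : tΘ ≠ 0 := by
    rw [← norm_pos_iff, hΘ]; exact zpow_pos hϖ0 _
  have hcard : 1 ≤ Fintype.card I := Fintype.card_pos
  have he0 : (0 : ℤ) < absRamificationIdx p K := by exact_mod_cast absRamificationIdx_pos p K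
  rw [iota_smul_subset_packetHull_orbit_iota_smul_iff_card p K (cin := fun _ => cin) (cout := fun _ => cout)
    (fun _ => hcin0) (fun _ => hin) (fun _ => hmax) (fun _ => hcout0) (fun _ => houtΛ) (fun _ => hdom) b b' htΘ tq]
  simp only [Finset.prod_const, Finset.card_univ, hRin, hRout, hΘ, hq]
  -- both real inequalities in integer currency
  have hL : ∀ m : ℤ, ((p : ℝ) ^ m * ‖(ϖ : K)‖ ^ M ≤
      (p : ℝ) ^ (-(((Fintype.card I : ℝ) - 1) * differentOrd p K)) * (‖(ϖ : K)‖ ^ Rin) ^ Fintype.card I) ↔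
        m * (absRamificationIdx p K : ℤ) ≤ M - (Fintype.card I - 1 : ℕ) * (D : ℤ) - Fintype.card I * Rin := by
    intro m
    rw [zpow_mul_norm_zpow_le_iff p hϖ m M Rin (((Fintype.card I : ℝ) - 1) * differentOrd p K) (Fintype.card I), hD]
    have he : (absRamificationIdx p K : ℝ) ≠ 0 := by exact_mod_cast (absRamificationIdx_pos p K).ne'
    have h1 : -(((Fintype.card I : ℝ) - 1) * ((D : ℝ) / absRamificationIdx p K)) * absRamificationIdx p K =
        -(((Fintype.card I : ℝ) - 1) * D) := by field_simp
    rw [h1]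
    have hc : (((Fintype.card I - 1 : ℕ) : ℤ) : ℝ) = (Fintype.card I : ℝ) - 1 := by
      rw [Int.cast_natCast, Nat.cast_sub hcard, Nat.cast_one]
    constructor
    · intro h
      have h' : ((m * (absRamificationIdx p K : ℤ) : ℤ) : ℝ) ≤
          ((M - (Fintype.card I - 1 : ℕ) * (D : ℤ) - Fintype.card I * Rin : ℤ) : ℝ) := by
        push_cast; rw [Nat.cast_sub hcard]; push_cast; linarith
      exact_mod_cast h'
    · intro h
      have h' : ((m * (absRamificationIdx p K : ℤ) : ℤ) : ℝ) ≤
          ((M - (Fintype.card I - 1 : ℕ) * (D : ℤ) - Fintype.card I * Rin : ℤ) : ℝ) := by exact_mod_cast h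
      push_cast at h'; rw [Nat.cast_sub hcard] at h'; push_cast at h'; linarith
  have hR : ∀ m : ℤ, ((p : ℝ) ^ m * ‖(ϖ : K)‖ ^ mq ≤ (‖(ϖ : K)‖ ^ Rout) ^ Fintype.card I) ↔
      (absRamificationIdx p K : ℤ) * m + Fintype.card I * Rout ≤ mq := by
    intro m
    have h := zpow_mul_norm_zpow_le_iff p hϖ m mq Rout 0 (Fintype.card I)
    rw [neg_zero, Real.rpow_zero, one_mul] at h
    rw [h]
    constructor
    · intro h'
      have h'' : (((absRamificationIdx p K : ℤ) * m + Fintype.card I * Rout : ℤ) : ℝ) ≤ ((mq : ℤ) : ℝ) := by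
        push_cast; linarith
      exact_mod_cast h''
    · intro h'
      have h'' : (((absRamificationIdx p K : ℤ) * m + Fintype.card I * Rout : ℤ) : ℝ) ≤ ((mq : ℤ) : ℝ) := by exact_mod_cast h'
      push_cast at h''; linarith
  simp_rw [hL, hR]
  exact forall_int_mul_le_imp_iff_ediv he0 _ _ _

/-- **THE CELL IN INTEGER ORDERS, FACTORWISE (Ind2)** ([IUTchIII] Thm. 3.11 (i)'s independent lattice automorphisms per slot —
the typed (Ind2) of the cell's real settings): same integer predicate
**`e·⌊(M − (|I|−1)·D − |I|·R_in)/e⌋ + |I|·R_out ≤ m_q`** (abc-iut-w5-d180 g4: the factorwise orbit has the same hull).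
[cite: Mochizuki2012, IUTchIII Thm. 3.11 (i) (Ind2) p. 154] [cite: DupuyHilado2025, §4.9, §4.12] -/
theorem iota_smul_subset_packetHull_factorwiseOrbit_iota_smul_iff_orders {ϖ : Kˣ} (hϖ : IsUniformizer ϖ) {D : ℕ}
    (hD : differentOrd p K = (D : ℝ) / absRamificationIdx p K) {cin cout : K}
    (hin : ∀ o : K, ‖o‖ ≤ 1 → cin * o ∈ logUnits K)
    (hmax : ∃ (ϖ' : Kˣ) (w : K), IsUniformizer ϖ' ∧ w ∉ logUnits K ∧ ‖w‖ * ‖(ϖ' : K)‖ ≤ ‖cin‖)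
    (houtΛ : cout ∈ logUnits K) (hdom : ∀ z ∈ logUnits K, ‖z‖ ≤ ‖cout‖)
    {Rin Rout : ℤ} (hRin : ‖cin‖ = ‖(ϖ : K)‖ ^ Rin) (hRout : ‖cout‖ = ‖(ϖ : K)‖ ^ Rout)
    (b b' : I) {tΘ tq : K} {M mq : ℤ} (hΘ : ‖tΘ‖ = ‖(ϖ : K)‖ ^ M) (hq : ‖tq‖ = ‖(ϖ : K)‖ ^ mq) :
    iota p (fun _ : I => K) b' tq • (normalizedPacket p (fun _ : I => K) : Set (PacketAlgebra p (fun _ : I => K))) ⊆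
        packetHull p (fun _ : I => K) (⋃ g ∈ {g : ∀ _ : I, K ≃ₗ[ℚ_[p]] K | ∀ i, g i '' logUnits K = logUnits K},
          (PiTensorProduct.congr g : PacketAlgebra p (fun _ : I => K) ≃ₗ[ℚ_[p]] PacketAlgebra p (fun _ : I => K)) ''
            (iota p (fun _ : I => K) b tΘ • (normalizedPacket p (fun _ : I => K) : Set (PacketAlgebra p (fun _ : I => K))))) ↔
      (absRamificationIdx p K : ℤ) * ((M - (Fintype.card I - 1 : ℕ) * (D : ℤ) - Fintype.card I * Rin) / absRamificationIdx p K) +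
          Fintype.card I * Rout ≤ mq := by
  have hϖ0 : 0 < ‖(ϖ : K)‖ := norm_pos_iff.2 ϖ.ne_zero
  have hcin0 : cin ≠ 0 := by
    rw [← norm_pos_iff, hRin]; exact zpow_pos hϖ0 _
  have hcout0 : cout ≠ 0 := by
    rw [← norm_pos_iff, hRout]; exact zpow_pos hϖ0 _
  have htΘ : tΘ ≠ 0 := by
    rw [← norm_pos_iff, hΘ]; exact zpow_pos hϖ0 _
  rw [iota_smul_subset_packetHull_factorwiseOrbit_iota_smul_iff_card p K (cin := fun _ => cin) (cout := fun _ => cout)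
    (fun _ => hcin0) (fun _ => hin) (fun _ => hmax) (fun _ => hcout0) (fun _ => houtΛ) (fun _ => hdom) b b' htΘ tq,
    ← iota_smul_subset_packetHull_orbit_iota_smul_iff_card p K (cin := fun _ => cin) (cout := fun _ => cout)
    (fun _ => hcin0) (fun _ => hin) (fun _ => hmax) (fun _ => hcout0) (fun _ => houtΛ) (fun _ => hdom) b b' htΘ tq]
  exact iota_smul_subset_packetHull_orbit_iota_smul_iff_orders p hϖ hD hin hmax houtΛ hdom hRin hRout b b' hΘ hq

end Orders

end Literature.IUT.LogVolume

end
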